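import Summits.ValiantsHypothesis.ValiantsHypothesis.Theses.MonotoneRestoration
import Summits.ValiantsHypothesis.ValiantsHypothesis.Theorems.MonotoneRestorationOrbitCut
import Summits.ValiantsHypothesis.ValiantsHypothesis.Theorems.MonotoneRestorationCruxToTarget
import Summits.ValiantsHypothesis.ValiantsHypothesis.Theorems.MonotoneRestorationTargetImpliesCrux
import Summits.ValiantsHypothesis.ValiantsHypothesis.Theorems.MonotoneRestorationSensitiveBridge
import Summits.ValiantsHypothesis.ValiantsHypothesis.Theorems.MonotoneRestorationDenseSubtraction

/-!
# `MonotoneRestorationQP` (stmt-ValiantsHypothesis-15886) is, by name, `OrbitRestorationQP ∧ OrbitCompressionQP`, and is the target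

The registered line `linear_width` of crux `MonotoneRestorationQP` (skeleton 447dbbe2994c48fa) composes its four stubs
through THEOREM ε; independently of that line, the route's certified ORBIT CUT says the crux is the conjunction of the two
route items `OrbitRestorationQP` (stmt-18293) and `OrbitCompressionQP` (stmt-18332).  The converses
(`crux_implies_orbitRestoration`, `crux_implies_orbitCompression`) were so far only checked Cruxes-side
(`Cruxes/MonotoneRestorationQP/Lines/Sketch.lean`).  This file records both directions as tree theorems, unconditionally:

* `orbitRestorationQP_of_monotoneRestorationQP`, `orbitCompressionQP_of_monotoneRestorationQP` (THEOREM ε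
  `monotoneRestorationQP_iff_complexRestorationQP` and `LabelledArithCircuit.orbitSize_le_size`);
* `monotoneRestorationQP_iff_orbitCut : MonotoneRestorationQP ↔ (OrbitRestorationQP ∧ OrbitCompressionQP)`;
* `monotoneRestorationQP_iff_nonnegRestorationQP : MonotoneRestorationQP ↔ NonnegRestorationQP` — the landed
  `monotoneRestorationQP_iff_target` with its three hypotheses (`SensitiveBridge`, `DenseSubtraction`, `CruxToTarget`)
  DISCHARGED by the landed proofs.

So, by name and in the kernel: stmt-15886 ⟺ stmt-16191 ⟺ stmt-18293 ∧ stmt-18332.  Honest label: bookkeeping over landed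
theorems; no stub of line `linear_width` is closed; VP ≠ VNP is not touched.
-/

noncomputable section

-- the summit and the problem share the name `ValiantsHypothesis` (D-0017 single-conjunct layout)
set_option linter.dupNamespace false

namespace Summit.ValiantsHypothesis.ValiantsHypothesis.Theorems.MonotoneRestorationQPOrbitCut

open Summit.ValiantsHypothesis.ValiantsHypothesis.Theses.MonotoneRestoration
open Literature.Computability.AlgebraicComplexity

/-- **`MonotoneRestorationQP → OrbitRestorationQP`** (stmt-15886 ⇒ stmt-18293): THEOREM ε gives square-symmetric circuits
of quasi-polynomial SIZE for every matrix-symmetric `VP` family over `ℂ`, and size bounds orbit size. [folklore] -/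
theorem orbitRestorationQP_of_monotoneRestorationQP (h : MonotoneRestorationQP) : OrbitRestorationQP := by
  intro f hs hVP
  obtain ⟨c, hc⟩ :=
    Summit.ValiantsHypothesis.ValiantsHypothesis.Theorems.monotoneRestorationQP_iff_complexRestorationQP.mp h f hs hVP
  refine ⟨c, fun n => ?_⟩
  obtain ⟨G, inst, C, hCs, hCe, hCc⟩ := hc n
  exact ⟨G, inst, C, hCs, hCe, (C.orbitSize_le_size (Equiv.Perm (Fin n))).trans hCc⟩

/-- **`MonotoneRestorationQP → OrbitCompressionQP`** (stmt-15886 ⇒ stmt-18332): the size bound of THEOREM ε holds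
outright (the orbit hypothesis is not used). [folklore] -/
theorem orbitCompressionQP_of_monotoneRestorationQP (h : MonotoneRestorationQP) : OrbitCompressionQP :=
  fun f hs hVP _ =>
    Summit.ValiantsHypothesis.ValiantsHypothesis.Theorems.monotoneRestorationQP_iff_complexRestorationQP.mp h f hs hVP

/-- **`MonotoneRestorationQP ↔ OrbitRestorationQP ∧ OrbitCompressionQP`** — the certified orbit cut, both directions,
as one tree theorem (`⇐` is the landed `OrbitCut`). [folklore] -/
theorem monotoneRestorationQP_iff_orbitCut :
    MonotoneRestorationQP ↔ (OrbitRestorationQP ∧ OrbitCompressionQP) :=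
  ⟨fun h => ⟨orbitRestorationQP_of_monotoneRestorationQP h, orbitCompressionQP_of_monotoneRestorationQP h⟩,
    fun h => Summit.ValiantsHypothesis.ValiantsHypothesis.Theorems.MonotoneRestoration.orbitCut_proof h.1 h.2⟩

/-- **`MonotoneRestorationQP ↔ NonnegRestorationQP`** (stmt-15886 ⟺ stmt-16191), UNCONDITIONALLY: the landed
`monotoneRestorationQP_iff_target` with its hypotheses discharged by the landed `sensitiveBridge_proof`,
`denseSubtraction_proof`, `monotoneRestoration_cruxToTarget_proof`. [folklore] -/
theorem monotoneRestorationQP_iff_nonnegRestorationQP : MonotoneRestorationQP ↔ NonnegRestorationQP :=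
  Summit.ValiantsHypothesis.ValiantsHypothesis.Theorems.monotoneRestorationQP_iff_target
    Summit.ValiantsHypothesis.ValiantsHypothesis.Theorems.MonotoneRestorationSensitive.sensitiveBridge_proof
    Summit.ValiantsHypothesis.ValiantsHypothesis.Theorems.denseSubtraction_proof
    Summit.ValiantsHypothesis.ValiantsHypothesis.Theorems.monotoneRestoration_cruxToTarget_proof

end Summit.ValiantsHypothesis.ValiantsHypothesis.Theorems.MonotoneRestorationQPOrbitCut

end
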